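import Summits.HodgeConjecture.HodgeConjecture.Theorems.DeltaPeriodAuditHodgeForcesNewformPeriodRatioIrrationalPeriodDictionary
import Literature.NumberTheory.EllipticCurves.NewformOpenImageGaloisProofs
import Literature.NumberTheory.EllipticCurves.NewformsLiftProofs
import Literature.NumberTheory.EllipticCurves.NewformsProofs
import Literature.NumberTheory.EllipticCurves.NewformsRealCoefficients
import Literature.NumberTheory.EllipticCurves.GreenbergSelmerOrdinaryFiltrationProofs
import Literature.NumberTheory.EllipticCurves.PAdicLFunctionDistributionProofs
import Literature.NumberTheory.GaloisRepresentations.AbsGaloisGroup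
import HarnessLib

/-!
# Crux `HodgeForcesNewformPeriodRatioIrrational` (stmt-HodgeConjecture-2365), line `birth` — stub B
# `stub_rationalScalar_of_galoisCommutant`: OPEN IMAGE ⟹ RATIONAL SCALAR COMMUTANT

Route `HodgeConjecture/DeltaPeriodAudit`; registered skeleton
`Cruxes/HodgeForcesNewformPeriodRatioIrrational/Lines/birth.lean` (`HodgeForcesNewformPeriodRatioIrrational_of`:
STUB A Scholl's motive as a Betti–`ℓ`-adic system obeying Deligne's principle under HC (XL, open) → STUB B (this
file) → STUB C (landed, `DeltaPeriodAuditHodgeForcesNewformPeriodRatioIrrationalPeriodDictionary.lean`)). After this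
file the crux is, in the kernel, exactly STUB A.

**Theorem** (`stub_rationalScalar_of_galoisCommutant`, the registered signature verbatim). Let `f ∈ S_k(Γ₀(N))`,
`k ≥ 2`, be a newform with `K_f = ℚ` and without complex multiplication (Ribet: no Dirichlet character `η ≠ 1` with
`η(p) a_p = a_p` for almost all `p`), `ℓ` a prime, `ρ : Γ_ℚ → GL₂(ℚ_ℓ)` a continuous representation attached to the
`Γ₁(N)`-lift of `f` away from `N ℓ`, `V` a `ℚ`-vector space with a framing `θ : ℚ_ℓ ⊗_ℚ V ≃ ℚ_ℓ²`, and `B` a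
`ℚ`-endomorphism of `V` whose transport `θ (B ⊗ 1) θ⁻¹` commutes with `ρ(g)` for all `g` in an open subgroup
`U ≤ Γ_ℚ`. Then `B = c • id` for a RATIONAL `c`.

Proof. (§4) The lift is a `Γ₁(N)`-newform with `ℚ(a_n, ε(n)) = ℚ` (`isNewform1_liftToGamma1_iff_holds`,
`coeffCharField_liftToGamma1_le`) and the same non-CM clause (`coe_liftToGamma1_holds`,
`IsNewform0.heckeEigenvalue_eq_coeff_holds`), so `ρ(Γ_ℚ)` is open in `GL₂(ℚ_ℓ)` by the tree's open-image theorem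
`momose_isOpen_range_galoisRep_holds` (Ribet 1985 §3 after Momose; Serre–Swinnerton-Dyer for `N = 1`). (§1) A
continuous homomorphism out of a compact group with open range is an open map (the range factorisation is a closed,
hence quotient, map and the saturation `S · ker ρ` of an open set is open), so `ρ(U)` is an open neighbourhood of `1`.
(§2) It therefore contains the elementary unipotents `(1 t; 0 1)` and `(1 0; t 1)` for some `t ≠ 0` (the
one-parameter families are continuous into `GL₂(ℚ_ℓ)` and `0` is not isolated in `ℚ_ℓ`), and a `2 × 2` matrix
commuting with both is a scalar `c ∈ ℚ_ℓ`. (§3) Finally `B ⊗ 1 = c • 1` on `ℚ_ℓ ⊗ V` forces `c ∈ ℚ` and `B = c • id`: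
rational functionals separate the points of `V` (`Module.forall_dual_apply_eq_zero_iff`) and `ℚ → ℚ_ℓ` is injective.

§4 states the stub in the registered spelling (file-local notation `transport`, `GaloisEquivariantOnOpen` for the
skeleton's two definitions; display only).

HONEST STATUS. Nothing here is a case of the Hodge conjecture; the open-image theorem is the tree's (its own
dependencies are whatever `NewformOpenImageGaloisProofs` rests on); STUB A (Scholl's motive under HC, XL) remains the
crux. No definition, no named fact, no sorry.
References: [Ribet1985] §3 p. 191 and Introduction (1); [Momose1981]; [SerreAbelianLadic1968] Ch. IV §2.2;
[DiamondShurman2005] §4.3 (`S_k(Γ₀(N)) = S_k(N, 𝟙)`).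
-/

noncomputable section

set_option linter.dupNamespace false

open scoped TensorProduct
open Literature.NumberTheory.EllipticCurves.ModularForms
open Literature.NumberTheory.GaloisRepresentations
open Topology Filter

namespace Summit.HodgeConjecture.HodgeConjecture.Theorems.HodgeForcesNewformPeriodRatioIrrational

/-! ## §1 Topological groups: a continuous homomorphism with open range out of a compact group is open -/

section OpenImage

variable {G H : Type*} [Group G] [TopologicalSpace G] [IsTopologicalGroup G] [Group H]
  {Φ : Type*} [FunLike Φ G H] [MonoidHomClass Φ G H]

/-- The saturation `ρ⁻¹(ρ(S)) = S · ker ρ` of an open set under a group homomorphism is open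
(a union of right translates of `S`). [folklore] -/
theorem isOpen_preimage_image (ρ : Φ) {S : Set G} (hS : IsOpen S) :
    IsOpen (ρ ⁻¹' (ρ '' S)) := by
  rw [isOpen_iff_forall_mem_open]
  rintro g ⟨s, hs, hsg⟩
  refine ⟨(fun x ↦ x * (s⁻¹ * g)) '' S, ?_, (isOpenMap_mul_right _) _ hS,
    ⟨s, hs, by simp⟩⟩
  rintro _ ⟨x, hx, rfl⟩
  exact ⟨x, hx, by rw [map_mul, map_mul, map_inv, ← hsg, inv_mul_cancel, mul_one]⟩

/-- **A continuous homomorphism out of a compact group whose range is open is an open map**: the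
range factorisation `G → ρ(G)` is a closed, hence quotient, map (compact to Hausdorff), the
saturation of an open set is open, and `ρ(G)` is open in `H`. In particular the image of an open
subgroup (closed of finite index in `ρ(G)`) is open — Serre, *Abelian ℓ-adic representations*,
IV-23, remark on finite-index subgroups of `ℓ`-adic Lie groups. [cite: SerreAbelianLadic1968, Ch. IV §2.2] -/
theorem isOpen_image_of_isOpen_range [CompactSpace G] [TopologicalSpace H] [T2Space H]
    (ρ : Φ) (hρ : Continuous ρ)
    (hrange : IsOpen (Set.range ρ)) {S : Set G} (hS : IsOpen S) : IsOpen (ρ '' S) := by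
  have hφc : Continuous (Set.rangeFactorization ρ) := hρ.rangeFactorization
  have hq : IsQuotientMap (Set.rangeFactorization ρ) :=
    hφc.isClosedMap.isQuotientMap hφc Set.rangeFactorization_surjective
  have hpre : IsOpen ((Subtype.val : Set.range ρ → H) ⁻¹' (ρ '' S)) := by
    rw [← hq.isOpen_preimage]
    exact isOpen_preimage_image ρ hS
  have h := hrange.isOpenMap_subtype_val _ hpre
  rwa [Subtype.image_preimage_coe, Set.inter_eq_right.2 (Set.image_subset_range _ _)] at h

end OpenImage

/-! ## §2 `GL₂` over a nontrivially normed field: unipotents near `1`, and their commutant -/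

section Commutant

variable {K : Type*} [NontriviallyNormedField K]

/-- **An open neighbourhood of `1` in `GL₂(K)` contains the elementary unipotents `(1 t; 0 1)` and
`(1 0; t 1)` for some `t ≠ 0`** (the one-parameter unipotent subgroups are continuous and `0` is
not isolated in `K`). [folklore] -/
theorem exists_unipotent_mem {O : Set (GL (Fin 2) K)} (hO : IsOpen O) (h1 : (1 : GL (Fin 2) K) ∈ O) :
    ∃ t : K, t ≠ 0 ∧ (∃ g ∈ O, ((g : GL (Fin 2) K) : Matrix (Fin 2) (Fin 2) K) = !![1, t; 0, 1]) ∧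
      (∃ g ∈ O, ((g : GL (Fin 2) K) : Matrix (Fin 2) (Fin 2) K) = !![1, 0; t, 1]) := by
  -- the two one-parameter unipotent families, as continuous maps `K → GL₂(K)`
  let u : K → GL (Fin 2) K := fun t ↦
    ⟨!![1, t; 0, 1], !![1, -t; 0, 1], by simp [Matrix.one_fin_two],
      by simp [Matrix.one_fin_two]⟩
  let l : K → GL (Fin 2) K := fun t ↦
    ⟨!![1, 0; t, 1], !![1, 0; -t, 1], by simp [Matrix.one_fin_two],
      by simp [Matrix.one_fin_two]⟩
  have hu : Continuous u := by
    refine Units.continuous_iff.2 ⟨?_, ?_⟩ <;>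
    · refine continuous_matrix fun i j ↦ ?_
      fin_cases i <;> fin_cases j <;> simp [u] <;> fun_prop
  have hl : Continuous l := by
    refine Units.continuous_iff.2 ⟨?_, ?_⟩ <;>
    · refine continuous_matrix fun i j ↦ ?_
      fin_cases i <;> fin_cases j <;> simp [l] <;> fun_prop
  have hu1 : u 0 = 1 := Units.ext (by simp [u, Matrix.one_fin_two])
  have hl1 : l 0 = 1 := Units.ext (by simp [l, Matrix.one_fin_two])
  have hu0 : u ⁻¹' O ∈ 𝓝 (0 : K) := (hO.preimage hu).mem_nhds (by rw [Set.mem_preimage, hu1]; exact h1)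
  have hl0 : l ⁻¹' O ∈ 𝓝 (0 : K) := (hO.preimage hl).mem_nhds (by rw [Set.mem_preimage, hl1]; exact h1)
  obtain ⟨t, ⟨htu, htl⟩, ht0⟩ := Filter.nonempty_of_mem (f := 𝓝[≠] (0 : K))
    (Filter.inter_mem (mem_nhdsWithin_of_mem_nhds (Filter.inter_mem hu0 hl0)) self_mem_nhdsWithin)
  exact ⟨t, Set.mem_compl_singleton_iff.1 ht0, ⟨u t, htu, rfl⟩, ⟨l t, htl, rfl⟩⟩

variable {F : Type*} [Field F]

/-- **The commutant of the two elementary unipotents `(1 t; 0 1)`, `(1 0; t 1)` (`t ≠ 0`) in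
`End(F²)` is the scalars.** [folklore] -/
theorem exists_eq_smul_id_of_commute_unipotent {t : F} (ht : t ≠ 0)
    {T : (Fin 2 → F) →ₗ[F] (Fin 2 → F)}
    (hu : Matrix.toLin' !![1, t; 0, 1] ∘ₗ T = T ∘ₗ Matrix.toLin' !![1, t; 0, 1])
    (hl : Matrix.toLin' !![1, 0; t, 1] ∘ₗ T = T ∘ₗ Matrix.toLin' !![1, 0; t, 1]) :
    ∃ c : F, T = c • LinearMap.id := by
  obtain ⟨A, rfl⟩ : ∃ A : Matrix (Fin 2) (Fin 2) F, T = Matrix.toLin' A :=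
    ⟨LinearMap.toMatrix' T, (Matrix.toLin'_toMatrix' T).symm⟩
  rw [← Matrix.toLin'_mul, ← Matrix.toLin'_mul] at hu hl
  have hu' := Matrix.toLin'.injective hu
  have hl' := Matrix.toLin'.injective hl
  rw [Matrix.eta_fin_two A] at hu' hl' ⊢
  simp only [Matrix.mul_fin_two] at hu' hl'
  have h00 := congrFun (congrFun hu' 0) 0
  have h01 := congrFun (congrFun hu' 0) 1
  have h00' := congrFun (congrFun hl' 0) 0
  simp only [Matrix.of_apply, Matrix.cons_val', Matrix.cons_val_zero, Matrix.cons_val_one,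
    Matrix.empty_val', Matrix.cons_val_fin_one] at h00 h01 h00'
  -- `h00 : 1 * A 0 0 + t * A 1 0 = A 0 0 * 1 + A 0 1 * 0`, etc.
  have hc : A 1 0 = 0 := by
    have : t * A 1 0 = 0 := by linear_combination h00
    exact (mul_eq_zero.1 this).resolve_left ht
  have hb : A 0 1 = 0 := by
    have : t * A 0 1 = 0 := by linear_combination -h00'
    exact (mul_eq_zero.1 this).resolve_left ht
  have hd : A 1 1 = A 0 0 := by
    have : t * (A 1 1 - A 0 0) = 0 := by linear_combination h01
    exact sub_eq_zero.1 ((mul_eq_zero.1 this).resolve_left ht)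
  refine ⟨A 0 0, ?_⟩
  rw [hb, hc, hd, show !![A 0 0, (0 : F); 0, A 0 0] = A 0 0 • (1 : Matrix (Fin 2) (Fin 2) F) by
    rw [Matrix.one_fin_two, Matrix.smul_of]; simp, map_smul, Matrix.toLin'_one]

end Commutant

/-! ## §3 Descent of a scalar from `K ⊗_ℚ V` to `V` -/

section Descent

variable {K : Type*} [Field K] [Algebra ℚ K] {V : Type*} [AddCommGroup V] [Module ℚ V]

/-- **A `ℚ`-endomorphism whose base change to a field `K ⊇ ℚ` is a scalar is a RATIONAL scalar**
(`ℚ → K` is injective and rational functionals separate points). [folklore] -/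
theorem exists_eq_rat_smul_id_of_baseChange_eq_smul (B : V →ₗ[ℚ] V) {c : K}
    (hB : B.baseChange K = c • LinearMap.id) : ∃ q : ℚ, B = q • LinearMap.id := by
  have key : ∀ v : V, (1 : K) ⊗ₜ[ℚ] B v = c • ((1 : K) ⊗ₜ[ℚ] v) := fun v ↦ by
    simpa using LinearMap.congr_fun hB ((1 : K) ⊗ₜ[ℚ] v)
  have keyφ : ∀ (ψ : Module.Dual ℚ V) (v : V),
      algebraMap ℚ K (ψ (B v)) = c * algebraMap ℚ K (ψ v) := fun ψ v ↦ by
    have h := congrArg (Module.Dual.baseChange K ψ) (key v)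
    rw [map_smul, Module.Dual.baseChange_apply_tmul, Module.Dual.baseChange_apply_tmul,
      smul_eq_mul] at h
    rwa [Algebra.algebraMap_eq_smul_one, Algebra.algebraMap_eq_smul_one]
  by_cases hV : ∀ v : V, v = 0
  · exact ⟨0, LinearMap.ext fun v ↦ by rw [hV v, map_zero, map_zero]⟩
  push Not at hV
  obtain ⟨v₀, hv₀⟩ := hV
  obtain ⟨φ, hφ⟩ := Module.Projective.exists_dual_eq_one ℚ hv₀
  -- `c` is the rational number `q = φ (B v₀)`
  set q : ℚ := φ (B v₀) with hq
  have hc : c = algebraMap ℚ K q := by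
    have h := keyφ φ v₀
    rw [hφ, map_one, mul_one] at h
    exact h.symm
  refine ⟨q, LinearMap.ext fun v ↦ ?_⟩
  rw [LinearMap.smul_apply, LinearMap.id_apply, ← sub_eq_zero]
  refine (Module.forall_dual_apply_eq_zero_iff ℚ _).1 fun ψ ↦ ?_
  have h := keyφ ψ v
  rw [hc, ← map_mul] at h
  have h' := (algebraMap ℚ K).injective h
  rw [map_sub, map_smul, smul_eq_mul, h', sub_self]

end Descent

/-! ## §4 The stub, in the registered spelling -/

section Stub

/-- `transport θ B` — the skeleton's `θ ∘ (B ⊗ 1) ∘ θ⁻¹` (display only; nothing is defined). -/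
local notation3 "transport " θ:max B:max =>
  (LinearEquiv.toLinearMap θ ∘ₗ LinearMap.baseChange _ B ∘ₗ LinearEquiv.toLinearMap (LinearEquiv.symm θ))

/-- `GaloisEquivariantOnOpen ρ T` — the skeleton's "`T` commutes with `ρ(g)` for `g` in an open
subgroup of `Γ_ℚ`" (display only; nothing is defined). -/
local notation3 "GaloisEquivariantOnOpen " ρ:max T:max =>
  (∃ U : OpenSubgroup (Field.absoluteGaloisGroup ℚ), ∀ g ∈ U,
    FramedRep.toRepresentation ρ g ∘ₗ T = T ∘ₗ FramedRep.toRepresentation ρ g)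

/-- **Stub `stub_rationalScalar_of_galoisCommutant` (registered signature, verbatim in the
skeleton's spelling): open image ⟹ rational scalar commutant.** For a rational non-CM newform
`f ∈ S_k(Γ₀(N))`, `k ≥ 2`, a prime `ℓ` and `ρ : Γ_ℚ → GL₂(ℚ_ℓ)` attached to (the `Γ₁(N)`-lift of)
`f` away from `N ℓ`, a `ℚ`-endomorphism `B` of a `ℚ`-form `V` of `ℚ_ℓ²` whose transport commutes
with `ρ(g)` on an open subgroup `U ≤ Γ_ℚ` is a rational scalar: `ρ(Γ_ℚ)` is open
(`momose_isOpen_range_galoisRep_holds`, Ribet 1985 §3 after Momose), hence so is `ρ(U)`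
(`isOpen_image_of_isOpen_range`); it contains `(1 t; 0 1)`, `(1 0; t 1)` with `t ≠ 0`, whose
commutant is `ℚ_ℓ`; and a scalar base change descends (`exists_eq_rat_smul_id_of_baseChange_eq_smul`).
[cite: Ribet1985, §3 p. 191 (Momose's theorem) and Introduction (1)]
[cite: SerreAbelianLadic1968, Ch. IV §2.2] -/
theorem stub_rationalScalar_of_galoisCommutant :
    ∀ (N : ℕ) [NeZero N] (k : ℤ) (f : CuspForm (CongruenceSubgroup.Gamma0 N) k),
      2 ≤ k → IsNewform0 f → coeffField f = ⊥ →
      (¬ ∃ (M : ℕ) (η : DirichletCharacter ℂ M), η ≠ 1 ∧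
          ∀ᶠ p : ℕ in Filter.cofinite, p.Prime →
            η (p : ZMod M) * heckeEigenvalue f p = heckeEigenvalue f p) →
      ∀ (ℓ : ℕ) [Fact ℓ.Prime] (ι : coeffCharField (liftToGamma1 N k f) →+* ℚ_[ℓ])
        (ρ : FramedGaloisRep ℚ ℚ_[ℓ] 2),
        IsGaloisRepOfNewform1 (liftToGamma1 N k f) ι {p | p ∣ N * ℓ} ρ →
        ∀ (V : Type) [AddCommGroup V] [Module ℚ V]
          (θ : ℚ_[ℓ] ⊗[ℚ] V ≃ₗ[ℚ_[ℓ]] (Fin 2 → ℚ_[ℓ])) (B : V →ₗ[ℚ] V),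
          GaloisEquivariantOnOpen ρ (transport θ B) → ∃ c : ℚ, B = c • LinearMap.id := by
  intro N _ k f hk hf hQ hCM ℓ _ ι ρ hρ V _ _ θ B hB
  obtain ⟨U, hU⟩ := hB
  -- (1) the `Γ₁(N)`-lift of `f` satisfies the hypotheses of the open-image theorem
  have hf1 : IsNewform1 (liftToGamma1 N k f) := (isNewform1_liftToGamma1_iff_holds N k f).mpr hf
  have hf0 : f ≠ 0 := IsNormalized.ne_zero_gamma0 hf.2.2
  have hQ1 : coeffCharField (liftToGamma1 N k f) = ⊥ :=
    le_bot_iff.mp (hQ ▸ Literature.NumberTheory.EllipticCurves.GreenbergSelmer.coeffCharField_liftToGamma1_le hf0)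
  have hCM1 : ¬ ∃ (M : ℕ) (η : DirichletCharacter ℂ M), η ≠ 1 ∧
      ∀ᶠ p : ℕ in Filter.cofinite, p.Prime →
        η (p : ZMod M) * (UpperHalfPlane.qExpansion 1 ⇑(liftToGamma1 N k f)).coeff p =
          (UpperHalfPlane.qExpansion 1 ⇑(liftToGamma1 N k f)).coeff p := by
    rintro ⟨M, η, hη, hev⟩
    refine hCM ⟨M, η, hη, hev.mono fun p hp hpp ↦ ?_⟩
    have h := hp hpp
    rwa [coe_liftToGamma1_holds N k f, ← IsNewform0.heckeEigenvalue_eq_coeff_holds hf hpp] at h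
  -- (2) the image of `U` is open in `GL₂(ℚ_ℓ)` and contains `1`
  have hrange : IsOpen (Set.range ⇑ρ) :=
    momose_isOpen_range_galoisRep_holds (liftToGamma1 N k f) hk hf1 hQ1 hCM1 ℓ ι ρ hρ
  have hO : IsOpen (⇑ρ '' (U : Set (Field.absoluteGaloisGroup ℚ))) :=
    isOpen_image_of_isOpen_range ρ ρ.continuous hrange U.isOpen
  obtain ⟨t, ht, ⟨gu, ⟨γu, hγu, rfl⟩, hgu⟩, ⟨gl, ⟨γl, hγl, rfl⟩, hgl⟩⟩ :=
    exists_unipotent_mem hO ⟨1, U.one_mem, map_one _⟩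
  -- (3) the transport commutes with the two unipotents, hence is a scalar `c ∈ ℚ_ℓ`
  have hrep : ∀ γ : Field.absoluteGaloisGroup ℚ, FramedRep.toRepresentation ρ γ =
      Matrix.toLin' ((ρ γ : GL (Fin 2) ℚ_[ℓ]) : Matrix (Fin 2) (Fin 2) ℚ_[ℓ]) := fun γ ↦
    LinearMap.ext fun v ↦ by rw [FramedRep.toRepresentation_apply_apply, Matrix.toLin'_apply]
  have hcu := hU γu hγu
  have hcl := hU γl hγl
  rw [hrep, hgu] at hcu
  rw [hrep, hgl] at hcl
  obtain ⟨c, hc⟩ := exists_eq_smul_id_of_commute_unipotent ht hcu hcl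
  -- (4) so `B ⊗ 1 = c • 1`, and `c` is rational
  have hBK : B.baseChange ℚ_[ℓ] = c • LinearMap.id := by
    refine LinearMap.ext fun x ↦ θ.injective ?_
    have h := LinearMap.congr_fun hc (θ x)
    simp only [LinearMap.coe_comp, LinearEquiv.coe_coe, Function.comp_apply,
      LinearEquiv.symm_apply_apply, LinearMap.smul_apply, LinearMap.id_coe, id_eq] at h
    rw [LinearMap.smul_apply, LinearMap.id_apply, LinearEquiv.map_smul]
    exact h
  exact exists_eq_rat_smul_id_of_baseChange_eq_smul B hBK

/-! ## §5 The crux from STUB A alone -/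

open Literature.AlgebraicGeometry.Motives
open Summit.HodgeConjecture.HodgeConjecture.Theses.DeltaPeriodAudit (HodgeForcesNewformPeriodRatioIrrational)

/-- `compress D A` — the skeleton's compression `x ↦ Π_f (A x)` on `V_f` (display only; nothing is defined). -/
local notation3 "compress " D:max A:max =>
  LinearMap.restrict (HodgeStructure.Hom.toLinearMap (SchollBettiRealisation.proj D) ∘ₗ A)
    (fun x _ => LinearMap.mem_range_self (HodgeStructure.Hom.toLinearMap (SchollBettiRealisation.proj D))
      ((A : _ →ₗ[ℚ] _) x))

/-- **The crux `HodgeForcesNewformPeriodRatioIrrational` BY NAME from STUB A alone** (the skeleton's composition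
`HodgeForcesNewformPeriodRatioIrrational_of` with STUB B = `stub_rationalScalar_of_galoisCommutant` (this file) and
STUB C = `stub_periodRatioSq_irrational_of_hodgeEndScalar` (landed) discharged; `ℓ = 2`; `f` is real on the imaginary
axis by `IsNewform0.cuspCoeff_im_eq_zero` + `im_apply_ofComplex_mul_I_eq_zero`). The hypothesis is the registered
signature of `stub_schollMotive_of_hodgeConjecture` (Scholl's motive as a Betti–`ℓ`-adic system obeying Deligne's
principle under HC — XL, open), verbatim in the skeleton's spelling. [cite: Scholl1990, §1.2 Thm. 1.2.4]
[cite: Deligne1982HodgeCycles, Ex. 2.1(a), Prop. 2.9(b)] -/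
theorem hodgeForcesNewformPeriodRatioIrrational_of_schollMotive
    (hA : ∀ (N : ℕ) [NeZero N] (k : ℤ) (f : CuspForm (CongruenceSubgroup.Gamma0 N) k),
      3 ≤ k → IsNewform0 f → coeffField f = ⊥ →
      ∃ D : SchollBettiRealisation f,
        ∀ (ℓ : ℕ) [Fact ℓ.Prime],
          ∃ (ι : coeffCharField (liftToGamma1 N k f) →+* ℚ_[ℓ])
            (ρ : FramedGaloisRep ℚ ℚ_[ℓ] 2)
            (θ : ℚ_[ℓ] ⊗[ℚ] D.carrier ≃ₗ[ℚ_[ℓ]] (Fin 2 → ℚ_[ℓ])),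
            IsGaloisRepOfNewform1 (liftToGamma1 N k f) ι {p | p ∣ N * ℓ} ρ ∧
            (_root_.HodgeConjecture →
              ∀ A : HodgeStructure.Hom D.hodge D.hodge,
                GaloisEquivariantOnOpen ρ (transport θ (compress D A.toLinearMap)))) :
    HodgeForcesNewformPeriodRatioIrrational := by
  intro hHC N _ k f hk hf hQ hCM a b ha hb hab hsa hsb
  obtain ⟨D, hD⟩ := hA N k f hk hf hQ
  refine stub_periodRatioSq_irrational_of_hodgeEndScalar N k f D hQ
    (fun _ ht ↦ im_apply_ofComplex_mul_I_eq_zero f (fun n ↦ hf.cuspCoeff_im_eq_zero n) ht) ?_ a b ha hb hab hsa hsb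
  intro A
  haveI : Fact (Nat.Prime 2) := ⟨Nat.prime_two⟩
  obtain ⟨ι, ρ, θ, hρ, hgal⟩ := hD 2
  exact stub_rationalScalar_of_galoisCommutant N k f (by omega) hf hQ hCM 2 ι ρ hρ D.carrier θ
    (compress D A.toLinearMap) (hgal hHC A)

end Stub

end Summit.HodgeConjecture.HodgeConjecture.Theorems.HodgeForcesNewformPeriodRatioIrrational

end
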